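import Summits.BirchSwinnertonDyer.BirchSwinnertonDyer.Theorems.ThetaPartnerAtTwoSignedTransportAtTwoUnitOfInvariantsTwo
import Literature.NumberTheory.EllipticCurves.BurungaleTian2026.EtaSignedMainConjectureMuCriterionProofs

/-!
# Crux `SignedTransportAtTwo` (stmt-BirchSwinnertonDyer-20306, route `ThetaPartnerAtTwo`): the `Λ`-algebra
# CLOSING LEMMA «equal `μ` and `λ` + one divisibility ⇒ equal ideals» (lead prover bsd-wall-tp2-p1, `--supports`)

The route header (NOT DECOMPOSED YET) names "the `Λ`-algebra closing lemma (equal `λ`, `μ = 0` both sides + one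
divisibility ⇒ equal ideals)" as the last layer of K1. This file proves it for `Λ = ℤ_p⟦T⟧` at EVERY prime
`p`, on the tree's invariants `muInvariant p (Λ ⧸ (x))`, `lambdaInvariant p (Λ ⧸ (x))` of cyclic modules,
building on the landed §1 of `ThetaPartnerAtTwoSignedTransportAtTwoUnitOfInvariantsTwo` (p509603):

* §1 `exists_eq_C_pow_mul_coe_mul_unit` — Weierstrass normal form `h = p^k · P · u` (`P` distinguished,
  `u` a unit) of a non-zero `h ∈ Λ` (`p`-content + Mathlib's Weierstrass preparation theorem);
  `muInvariant_quotient_span_normalForm = k`, `lambdaInvariant_quotient_span_normalForm = deg P`.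
* §2 ADDITIVITY of `λ` on products of non-zero elements: `λ(Λ/(ab)) = λ(Λ/(a)) + λ(Λ/(b))` (normal forms
  multiply; distinguished × distinguished is distinguished); the `μ`-analogue is the tree's
  `BurungaleTian2026.muInvariant_quotient_mul` (imported, reused).
* §3 THE CLOSING LEMMA `exists_eq_C_pow_mul_unit_of_invariants_eq`: if `g, h ≠ 0`,
  `μ(Λ/(gh)) = μ(Λ/(g)) + m` and `λ(Λ/(gh)) = λ(Λ/(g))`, then `h = p^m · u` for a unit `u`; in particular
  (`span_eq_of_invariants_eq`, `m = 0`) `(g) = (gh)`: a divisibility between two elements with the same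
  `μ` and `λ` is an equality of ideals.

Pure algebra; nothing about elliptic curves. References: [Washington1997] Thm. 7.3, Lemma 13.7, Prop. 13.8,
§13.2; [Lang1980] Ch. 5 §2.
-/

-- D-0017: single-problem summit, so `Summit.BirchSwinnertonDyer.BirchSwinnertonDyer.…` repeats a
-- namespace BY DESIGN.
set_option linter.dupNamespace false
set_option autoImplicit false

noncomputable section

open scoped Polynomial

namespace Summit.BirchSwinnertonDyer.BirchSwinnertonDyer.Theorems.SignedTransportAtTwo

open Literature Literature.NumberTheory.EllipticCurves
  Literature.NumberTheory.EllipticCurves.IwasawaAlgebra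

variable (p : ℕ) [Fact p.Prime]

/-! ## §1. Weierstrass normal form and the invariants of a cyclic module -/

/-- **Weierstrass normal form in `Λ = ℤ_p⟦T⟧`.** Every non-zero `h ∈ Λ` is `h = C(p^k) · P · u` with
`P ∈ ℤ_p[T]` distinguished and `u ∈ Λˣ` (`p`-content, `exists_eq_C_pow_mul_and_map_residue_ne_zero`,
then Mathlib's `PowerSeries.exists_isWeierstrassFactorization`; Washington Lemma 13.7 + Thm. 7.3).
[cite: Washington1997, Thm. 7.3 and Lemma 13.7] -/
theorem exists_eq_C_pow_mul_coe_mul_unit {h : IwasawaAlgebra p} (h0 : h ≠ 0) :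
    ∃ (k : ℕ) (P : ℤ_[p][X]) (u : (IwasawaAlgebra p)ˣ),
      P.IsDistinguishedAt (IsLocalRing.maximalIdeal ℤ_[p]) ∧
        h = PowerSeries.C ((p : ℤ_[p]) ^ k) * (P : IwasawaAlgebra p) * (u : IwasawaAlgebra p) := by
  obtain ⟨k, b, hb, hbres⟩ := exists_eq_C_pow_mul_and_map_residue_ne_zero p h0
  obtain ⟨P, v, H⟩ := PowerSeries.exists_isWeierstrassFactorization hbres
  obtain ⟨u, hu⟩ := H.isUnit
  exact ⟨k, P, u, H.isDistinguishedAt, by rw [hb, H.eq_mul, ← hu, mul_assoc]⟩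

/-- `μ(Λ/(p^k · P · u)) = k` for `P` distinguished and `u` a unit (the unit does not change the ideal;
then `muInvariant_quotient_C_pow_mul_coe`). [cite: Washington1997, §13.2] -/
theorem muInvariant_quotient_span_normalForm (k : ℕ) {P : ℤ_[p][X]}
    (hP : P.IsDistinguishedAt (IsLocalRing.maximalIdeal ℤ_[p])) (u : (IwasawaAlgebra p)ˣ) :
    muInvariant p (IwasawaAlgebra p ⧸ Ideal.span
      {PowerSeries.C ((p : ℤ_[p]) ^ k) * (P : IwasawaAlgebra p) * (u : IwasawaAlgebra p)}) = k := by
  have hspan : Ideal.span {PowerSeries.C ((p : ℤ_[p]) ^ k) * (P : IwasawaAlgebra p) *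
      (u : IwasawaAlgebra p)} =
      Ideal.span {PowerSeries.C ((p : ℤ_[p]) ^ k) * (P : IwasawaAlgebra p)} :=
    Ideal.span_singleton_mul_right_unit u.isUnit _
  let 𝔭 : PrimeSpectrum (IwasawaAlgebra p) := ⟨augIdealP p, isPrime_augIdealP_holds p⟩
  refine Eq.trans ?_ (muInvariant_quotient_C_pow_mul_coe p k hP)
  rw [muInvariant_eq_toNat_lengthAt p _ 𝔭 rfl, muInvariant_eq_toNat_lengthAt p _ 𝔭 rfl,
    Module.lengthAt_eq_of_linearEquiv (Submodule.quotEquivOfEq _ _ hspan) 𝔭]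

/-- `λ(Λ/(p^k · P · u)) = deg P` for `P` distinguished and `u` a unit (the unit does not change the ideal;
then `lambdaInvariant_quotient_C_pow_mul_coe`). [cite: Washington1997, §13.2 Prop. 13.8] -/
theorem lambdaInvariant_quotient_span_normalForm (k : ℕ) {P : ℤ_[p][X]}
    (hP : P.IsDistinguishedAt (IsLocalRing.maximalIdeal ℤ_[p])) (u : (IwasawaAlgebra p)ˣ) :
    lambdaInvariant p (IwasawaAlgebra p ⧸ Ideal.span
      {PowerSeries.C ((p : ℤ_[p]) ^ k) * (P : IwasawaAlgebra p) * (u : IwasawaAlgebra p)}) =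
      P.natDegree := by
  have hspan : Ideal.span {PowerSeries.C ((p : ℤ_[p]) ^ k) * (P : IwasawaAlgebra p) *
      (u : IwasawaAlgebra p)} =
      Ideal.span {PowerSeries.C ((p : ℤ_[p]) ^ k) * (P : IwasawaAlgebra p)} :=
    Ideal.span_singleton_mul_right_unit u.isUnit _
  exact (lambdaInvariant_eq_of_linearEquiv p (Submodule.quotEquivOfEq _ _ hspan)).trans
    (lambdaInvariant_quotient_C_pow_mul_coe p k hP)

/-! ## §2. Additivity of `λ` on products (`μ`: `BurungaleTian2026.muInvariant_quotient_mul`) -/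

/-- **`λ(Λ/(ab)) = λ(Λ/(a)) + λ(Λ/(b))`** for non-zero `a, b ∈ Λ` (normal forms multiply and
`deg (PQ) = deg P + deg Q` for monic `P, Q`). [cite: Washington1997, §13.2 Prop. 13.8] -/
theorem lambdaInvariant_quotient_span_mul {a b : IwasawaAlgebra p} (ha : a ≠ 0) (hb : b ≠ 0) :
    lambdaInvariant p (IwasawaAlgebra p ⧸ Ideal.span {a * b}) =
      lambdaInvariant p (IwasawaAlgebra p ⧸ Ideal.span {a}) +
        lambdaInvariant p (IwasawaAlgebra p ⧸ Ideal.span {b}) := by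
  obtain ⟨k, P, u, hP, rfl⟩ := exists_eq_C_pow_mul_coe_mul_unit p ha
  obtain ⟨l, Q, v, hQ, rfl⟩ := exists_eq_C_pow_mul_coe_mul_unit p hb
  have hprod : PowerSeries.C ((p : ℤ_[p]) ^ k) * (P : IwasawaAlgebra p) * (u : IwasawaAlgebra p) *
      (PowerSeries.C ((p : ℤ_[p]) ^ l) * (Q : IwasawaAlgebra p) * (v : IwasawaAlgebra p)) =
      PowerSeries.C ((p : ℤ_[p]) ^ (k + l)) * ((P * Q : ℤ_[p][X]) : IwasawaAlgebra p) *
        ((u * v : (IwasawaAlgebra p)ˣ) : IwasawaAlgebra p) := by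
    rw [pow_add, map_mul, Polynomial.coe_mul, Units.val_mul]; ring
  rw [hprod, lambdaInvariant_quotient_span_normalForm p k hP u,
    lambdaInvariant_quotient_span_normalForm p l hQ v,
    lambdaInvariant_quotient_span_normalForm p (k + l) (hP.mul hQ) (u * v), hP.monic.natDegree_mul hQ.monic]

/-! ## §3. The closing lemma -/

/-- **CLOSING LEMMA («equal invariants + one divisibility ⇒ equal ideals», up to `p^m`).** For
non-zero `g, h ∈ Λ = ℤ_p⟦T⟧` and `m ≥ 0`: if `μ(Λ/(g·h)) = μ(Λ/(g)) + m` and `λ(Λ/(g·h)) = λ(Λ/(g))`,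
then `h = C(p^m) · u` for a unit `u ∈ Λˣ` (additivity gives `μ(Λ/(h)) = m`, `λ(Λ/(h)) = 0`, then
`exists_eq_C_pow_mul_unit_of_muInvariant_of_lambdaInvariant`). This is the last layer of the transport
argument for Kobayashi's main conjecture: Kato's divisibility `char X = (g)`, `g · h = p^m · ϖ L` plus
equality of the `μ`- and `λ`-invariants of both sides forces `(g) = (ϖ L)`.
[cite: Washington1997, §13.2 and Thm. 7.3] -/
theorem exists_eq_C_pow_mul_unit_of_invariants_eq {g h : IwasawaAlgebra p} (hg : g ≠ 0) (hh : h ≠ 0)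
    {m : ℕ}
    (hμ : muInvariant p (IwasawaAlgebra p ⧸ Ideal.span {g * h}) =
      muInvariant p (IwasawaAlgebra p ⧸ Ideal.span {g}) + m)
    (hlam : lambdaInvariant p (IwasawaAlgebra p ⧸ Ideal.span {g * h}) =
      lambdaInvariant p (IwasawaAlgebra p ⧸ Ideal.span {g})) :
    ∃ u : (IwasawaAlgebra p)ˣ, h = PowerSeries.C ((p : ℤ_[p]) ^ m) * (u : IwasawaAlgebra p) := by
  rw [BurungaleTian2026.muInvariant_quotient_mul hg hh] at hμ
  rw [lambdaInvariant_quotient_span_mul p hg hh] at hlam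
  exact exists_eq_C_pow_mul_unit_of_muInvariant_of_lambdaInvariant p hh (m := m) (by omega) (by omega)

/-- **Equal invariants + divisibility ⇒ equal ideals.** For non-zero `g, h ∈ Λ`: if `Λ/(g)` and
`Λ/(g·h)` have the same `μ` and the same `λ`, then `h` is a unit and `(g·h) = (g)`.
[cite: Washington1997, §13.2 and Thm. 7.3] -/
theorem span_eq_of_invariants_eq {g h : IwasawaAlgebra p} (hg : g ≠ 0) (hh : h ≠ 0)
    (hμ : muInvariant p (IwasawaAlgebra p ⧸ Ideal.span {g * h}) =
      muInvariant p (IwasawaAlgebra p ⧸ Ideal.span {g}))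
    (hlam : lambdaInvariant p (IwasawaAlgebra p ⧸ Ideal.span {g * h}) =
      lambdaInvariant p (IwasawaAlgebra p ⧸ Ideal.span {g})) :
    Ideal.span {g * h} = Ideal.span ({g} : Set (IwasawaAlgebra p)) := by
  obtain ⟨u, hu⟩ := exists_eq_C_pow_mul_unit_of_invariants_eq p hg hh (m := 0) (by rw [hμ, add_zero]) hlam
  rw [pow_zero, map_one, one_mul] at hu
  rw [hu]
  exact Ideal.span_singleton_mul_right_unit u.isUnit g

end Summit.BirchSwinnertonDyer.BirchSwinnertonDyer.Theorems.SignedTransportAtTwo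

end
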